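import Summits.QuantumFields.BalabanUV.Beta.GAN24.BlockFluxMassTower

/-!
# `BalabanUV.Beta.GAN24.BlockFluxMassTowerWeight` — binder row G-an2-4 ∕ (CONV-C), CT-W (route «WC-TL» ∕ (Q-R) «QR-LL», the (DIV) display of RULING R-gan24p1-g29-2):
# **THE FLUX TOWER IN TOTAL-MASS CURRENCY WITH COARSE-WEIGHT LEGS — NO DILATION LOSS PER LEVEL**: leaf-03 g62's «FLUX-REC» PART 6 §3 (`BlockFluxMassTower.exists_mass_regionSum_divV_transport`)
# iterated PART 5's FINE-RATE gain, so each level paid the dilation slack `Z_{δ_j}²·C_j²` (a constant per level, compounding as `(slack)^k`); this sequel (§3′ of leaf-01 g68's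
# W-2, journal l.46023; leaf-03 g62 W-5 l.46388: «§3′ THE WEIGHTED TOWER IS YOURS — GO») runs the SAME structural recursion on PART 6 §0's COARSE-WEIGHT gain
# `finsetSum_abs_sandwich_le_mass_weight`: per level ONE kernel-only scalar `g_j = |Fib d|²·|c_j·c_{H,j}|·|Fib d|²·h_{L,j}·h_{R,j}·Z_{E′,j}·Z_{E,j}` with the legs of `K_j`
# windowed by coarse-summable weights `E_j, E′_j` (e.g. (N1)'s block-label profile, `Z_E = Z_{κ₀}` COARSE) — the line the (DIV) display and an engine certificate should quote
# (G-an2-4 formalisation swarm → CRUX TEAM (2), leaf prover `b2b-balaban-gan24-formalise-leaf-01`, gen 68, INTENT I-leaf01-g68-5; module name PROVISIONAL)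

NOT IN PRINT; OUR BOOKKEEPING ([folklore] dominated-`tsum` bookkeeping: leaf-03's PART 6 §0 `finsetSum_abs_sandwich_le_mass_weight` ∕ §1 `summable_col_of_sum_prod_le ∕
tsum_cols_le_of_sum_prod_le` ∕ PART 2 `BlockFluxTower.regionSum_divV_transport ∕ exists_bdd_transport` ∕ PART 1 `BlockFluxRegion.regionSum_divV_e3OfK` BY NAME, `mmRead`'s block
structure as in PART 5; 0 `def`, 0 cited facts, 0 `def … : Prop`, 0 sorry).  HONEST FRAMING (cell contract, verbatim): «discharging `BetaPertH` makes Bałaban's UV stability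
UNCONDITIONAL — a real constructive-QFT result; it is NOT the continuum limit and NOT the Clay problem.»  HONEST DEPENDENCY (verbatim): «continuum YM on T⁴ ⇐ BetaPertH ∧ nine spine
estimates (0/9 proved); BetaPertH ⇐ (D1) ∧ (D4) ∧ CAP+tail; G-an2-4 gates asym, D1 and NE2/3/4.»

## What (generic `d`, relative blocking `N ≥ 1`)
§1 **`finsetSum_abs_smul_mmRead_sandwich_le_mass_weight`** — PART 5's `finsetSum_abs_smul_mmRead_sandwich_le_mass` in coarse-weight currency: legs windowed by `E, E′ ∈ [0,1]` with
   dilated-point sups `h_L, h_R` and coarse sums `≤ Z_E, Z_E′` ⟹ `Σ_{x′∈Fx} Σ_{z′∈Fz} |(c • mmRead N (K∘V∘K)) x′ z′ a b| ≤ |c|·|Fib d|²·h_L·h_R·Z_E′·Z_E·M₁`.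
§2 **`exists_mass_smul_mmRead_sandwich_weight`** — the output again admits a mass function (PART 6 §1), total `≤ |Fib d|²·(|c|·|Fib d|²·h_L·h_R·Z_E′·Z_E·M₁)`.
§3 **`exists_mass_regionSum_divV_transport_weight`** — THE WEIGHTED TOWER: kernels `K_j` decaying (for the identities) AND windowed per level by `(E_j, E′_j, h_{L,j}, h_{R,j}, Z_{E,j},
   Z_{E′,j})` (for the gain) ⟹ the flux of `transport (j S ↦ c_j • e3OfK N K_j S) m k S` through `T` admits a mass function of total
   `≤ (∏_{i<k} |Fib d|²·(|c_{m+i}·c_{H,m+i}|·|Fib d|²·h_{L,m+i}·h_{R,m+i}·Z_{E′,m+i}·Z_{E,m+i}))·M₁` — NO `Z_δ`, NO `C_j²`: the dilation slack of PART 6 §3 is gone at every level.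
LOCATED CAVEAT (as PART 5∕6): total mass is not the END's `BiLoc` density; no value of the literal's `h, Z_E` is asserted (R-1 (iii)'s `|Fib d|⁴·A²·Z_{κ₀}²·Lc^{−2}` per level comes out
when `h_L = h_R = A·(Lc^{d+2})⁻¹`, `Z_E = Z_E′ = Z_{κ₀}` and the END weight are inserted by the consumer); entrywise-absolute counting (blind to the kernel antisymmetry, my C-2∕C-3).
Decides nothing about (Q-R) ∕ (DIV) ∕ (DL) ∕ K-LL-4′; NEVER «G-an2-4 closed» as (CONV-C); NOT D1, NOT `BetaPertH`, NOT continuum, NOT Clay; not in print — our bookkeeping.  2026-08-22.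
-/

noncomputable section

open Finset
open scoped BigOperators
open Literature.MathematicalPhysics.QuantumFieldTheory
open Literature.MathematicalPhysics.QuantumFieldTheory.Balaban1983to89
open Literature.MathematicalPhysics.QuantumFieldTheory.Balaban1983to89.Beta
open B6BondElimination (unitVec)
open ExpKernelCalculus (MKer Site Decays comp Zl Zl_nonneg)
open OneStepResolventKernel (Fib)
open OneStepKernelFamily (colH)
open BalabanStepJetsSucc (mmRead mmRead_inl_inl)
open KernelWard (divV Bdd)
open AffineAveraging (box toSite)
open Summit.QuantumFields.BalabanUV.Beta.KernelWardRelative (gaugeWt)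
open Summit.QuantumFields.BalabanUV.Beta.SpineRooted (e3OfK)
open Summit.QuantumFields.BalabanUV.Beta.GAN24.AffineUnroll (transport transport_zero transport_succ)
open Summit.QuantumFields.BalabanUV.Beta.GAN24.E3SlotDivergence (divV_smul_family)
open Summit.QuantumFields.BalabanUV.Beta.GAN24.LayerLetterUnion (biUnion_box_image_eq)
open Summit.QuantumFields.BalabanUV.Beta.GAN24.BlockFluxRegion (regionSum_divV_e3OfK)
open Summit.QuantumFields.BalabanUV.Beta.GAN24.BlockFluxTower (exists_bdd_transport regionSum_divV_transport)
open Summit.QuantumFields.BalabanUV.Beta.GAN24.BlockFluxMassTower (finsetSum_abs_sandwich_le_mass_weight summable_col_of_sum_prod_le tsum_cols_le_of_sum_prod_le)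

namespace Summit.QuantumFields.BalabanUV.Beta.GAN24.BlockFluxMassTowerWeight

variable {d N : ℕ}

/-! ## §1 The ℓ¹ → ℓ¹ gain of the flux map in coarse-weight currency -/

section Weighted

variable {K V : MKer (d + 1) (Fib d)} {μ : Site (d + 1) → Site (d + 1) → ℝ} {E E' : Site (d + 1) → Site (d + 1) → ℝ} {hL hR ZE ZE' : ℝ}

/-- NOT IN PRINT; OUR BOOKKEEPING (PART 6 §0 through `mmRead`'s block structure, as in PART 5's `finsetSum_abs_smul_mmRead_sandwich_le_mass`).  **THE ℓ¹ → ℓ¹ GAIN OF THE FLUX MAP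
`c • mmRead N (K ∘ V ∘ K)` IN COARSE-WEIGHT CURRENCY**: `Σ_{x′∈Fx} Σ_{z′∈Fz} |(c • mmRead N (K∘V∘K)) x′ z′ a b| ≤ |c|·|Fib d|²·h_L·h_R·Z_E′·Z_E·M₁` — no dilation loss. -/
theorem finsetSum_abs_smul_mmRead_sandwich_le_mass_weight (hE0 : ∀ x p, 0 ≤ E x p) (hE1 : ∀ x p, E x p ≤ 1) (hE'0 : ∀ q z, 0 ≤ E' q z)
    (hE'1 : ∀ q z, E' q z ≤ 1) (hhL : 0 ≤ hL) (hhR : 0 ≤ hR)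
    (hKL : ∀ (x' p : Site (d + 1)) (a f : Fib d), |K ((N : ℤ) • x') p a f| ≤ hL * E x' p)
    (hKR : ∀ (q z' : Site (d + 1)) (f b : Fib d), |K q ((N : ℤ) • z') f b| ≤ hR * E' q z')
    (hZE : ∀ (p : Site (d + 1)) (Fx : Finset (Site (d + 1))), ∑ x' ∈ Fx, E x' p ≤ ZE)
    (hZE' : ∀ (q : Site (d + 1)) (Fz : Finset (Site (d + 1))), ∑ z' ∈ Fz, E' q z' ≤ ZE')
    (hμ0 : ∀ y w, 0 ≤ μ y w) (hVμ : ∀ y w f g, |V y w f g| ≤ μ y w) (hμy : ∀ w, Summable fun y => μ y w)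
    (hμw : Summable fun w => ∑' y, μ y w) (c : ℝ) (Fx Fz : Finset (Site (d + 1))) (a b : Fib d) :
    ∑ x' ∈ Fx, ∑ z' ∈ Fz, |(c • mmRead N (comp (comp K V) K)) x' z' a b|
      ≤ |c| * ((Fintype.card (Fib d) : ℝ) * ((Fintype.card (Fib d) : ℝ) * (hL * hR)) * ZE' * (ZE * ∑' w, ∑' y, μ y w)) := by
  have hZE0 : 0 ≤ ZE := le_trans (by simp) (hZE 0 ∅)
  have hZE'0 : 0 ≤ ZE' := le_trans (by simp) (hZE' 0 ∅)
  have htot : 0 ≤ (Fintype.card (Fib d) : ℝ) * ((Fintype.card (Fib d) : ℝ) * (hL * hR)) * ZE' * (ZE * ∑' w, ∑' y, μ y w) :=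
    mul_nonneg (mul_nonneg (by positivity) hZE'0) (mul_nonneg hZE0 (tsum_nonneg fun w => tsum_nonneg fun y => hμ0 y w))
  have e : ∀ x' z', |(c • mmRead N (comp (comp K V) K)) x' z' a b| = |c| * |mmRead N (comp (comp K V) K) x' z' a b| := fun x' z' => by
    simp only [Pi.smul_apply, smul_eq_mul, abs_mul]
  simp only [e, ← Finset.mul_sum]
  refine mul_le_mul_of_nonneg_left ?_ (abs_nonneg c)
  rcases a with α | m
  · rcases b with β | m'
    · simp only [mmRead_inl_inl]
      exact finsetSum_abs_sandwich_le_mass_weight hE0 hE1 hE'0 hE'1 hhL hhR hKL hKR hZE hZE' hμ0 hVμ hμy hμw Fx Fz (Sum.inr α) (Sum.inr β)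
    · have h0 : ∀ x' z' : Site (d + 1), |mmRead N (comp (comp K V) K) x' z' (Sum.inl α) (Sum.inr m')| = 0 := fun x' z' => by
        simp [mmRead]
      simp only [h0, Finset.sum_const_zero]
      exact htot
  · have h0 : ∀ x' z' : Site (d + 1), |mmRead N (comp (comp K V) K) x' z' (Sum.inr m) b| = 0 := fun x' z' => by
      cases b <;> simp [mmRead]
    simp only [h0, Finset.sum_const_zero]
    exact htot

/-! ## §2 The weighted gain re-establishes the mass-function hypothesis -/

/-- NOT IN PRINT; OUR BOOKKEEPING (§1 ⨾ PART 6 §1).  **THE OUTPUT AGAIN ADMITS A MASS FUNCTION, COARSE-WEIGHT CURRENCY**: `V′ := c • mmRead N (K ∘ V ∘ K)` is dominated entrywise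
by `μ′ x′ z′ := Σ_{a b} |V′ x′ z′ a b| ≥ 0` with summable columns ∕ column totals and TOTAL `≤ |Fib d|²·(|c|·|Fib d|²·h_L·h_R·Z_E′·Z_E·M₁)`. -/
theorem exists_mass_smul_mmRead_sandwich_weight (hE0 : ∀ x p, 0 ≤ E x p) (hE1 : ∀ x p, E x p ≤ 1) (hE'0 : ∀ q z, 0 ≤ E' q z)
    (hE'1 : ∀ q z, E' q z ≤ 1) (hhL : 0 ≤ hL) (hhR : 0 ≤ hR)
    (hKL : ∀ (x' p : Site (d + 1)) (a f : Fib d), |K ((N : ℤ) • x') p a f| ≤ hL * E x' p)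
    (hKR : ∀ (q z' : Site (d + 1)) (f b : Fib d), |K q ((N : ℤ) • z') f b| ≤ hR * E' q z')
    (hZE : ∀ (p : Site (d + 1)) (Fx : Finset (Site (d + 1))), ∑ x' ∈ Fx, E x' p ≤ ZE)
    (hZE' : ∀ (q : Site (d + 1)) (Fz : Finset (Site (d + 1))), ∑ z' ∈ Fz, E' q z' ≤ ZE')
    (hμ0 : ∀ y w, 0 ≤ μ y w) (hVμ : ∀ y w f g, |V y w f g| ≤ μ y w) (hμy : ∀ w, Summable fun y => μ y w)
    (hμw : Summable fun w => ∑' y, μ y w) (c : ℝ) :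
    ∃ μ' : Site (d + 1) → Site (d + 1) → ℝ,
      (∀ x z, 0 ≤ μ' x z) ∧ (∀ x z a b, |(c • mmRead N (comp (comp K V) K)) x z a b| ≤ μ' x z) ∧ (∀ z, Summable fun x => μ' x z) ∧
        (Summable fun z => ∑' x, μ' x z) ∧
        ∑' z, ∑' x, μ' x z ≤ ((Fintype.card (Fib d) : ℝ) * (Fintype.card (Fib d) : ℝ)) *
          (|c| * ((Fintype.card (Fib d) : ℝ) * ((Fintype.card (Fib d) : ℝ) * (hL * hR)) * ZE' * (ZE * ∑' w, ∑' y, μ y w))) := by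
  set out : Site (d + 1) → Site (d + 1) → ℝ :=
    fun x z => ∑ p : Fib d × Fib d, |(c • mmRead N (comp (comp K V) K)) x z p.1 p.2| with hout
  have h0 : ∀ x z, 0 ≤ out x z := fun x z => Finset.sum_nonneg fun p _ => abs_nonneg _
  have hdom : ∀ x z a b, |(c • mmRead N (comp (comp K V) K)) x z a b| ≤ out x z := by
    intro x z a b
    exact Finset.single_le_sum (f := fun p : Fib d × Fib d => |(c • mmRead N (comp (comp K V) K)) x z p.1 p.2|)
      (fun _ _ => abs_nonneg _) (Finset.mem_univ (a, b))
  have hsum : ∀ Fx Fz : Finset (Site (d + 1)), ∑ x ∈ Fx, ∑ z ∈ Fz, out x z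
      ≤ ((Fintype.card (Fib d) : ℝ) * (Fintype.card (Fib d) : ℝ)) *
          (|c| * ((Fintype.card (Fib d) : ℝ) * ((Fintype.card (Fib d) : ℝ) * (hL * hR)) * ZE' * (ZE * ∑' w, ∑' y, μ y w))) := by
    intro Fx Fz
    have e : ∑ x ∈ Fx, ∑ z ∈ Fz, out x z = ∑ p : Fib d × Fib d, ∑ x ∈ Fx, ∑ z ∈ Fz, |(c • mmRead N (comp (comp K V) K)) x z p.1 p.2| := by
      simp only [hout]
      rw [Finset.sum_congr rfl (fun x _ => Finset.sum_comm), Finset.sum_comm]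
    rw [e]
    calc ∑ p : Fib d × Fib d, ∑ x ∈ Fx, ∑ z ∈ Fz, |(c • mmRead N (comp (comp K V) K)) x z p.1 p.2|
        ≤ ∑ _p : Fib d × Fib d, |c| * ((Fintype.card (Fib d) : ℝ) * ((Fintype.card (Fib d) : ℝ) * (hL * hR)) * ZE'
            * (ZE * ∑' w, ∑' y, μ y w)) :=
          Finset.sum_le_sum fun p _ =>
            finsetSum_abs_smul_mmRead_sandwich_le_mass_weight hE0 hE1 hE'0 hE'1 hhL hhR hKL hKR hZE hZE' hμ0 hVμ hμy hμw c Fx Fz p.1 p.2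
      _ = _ := by rw [Finset.sum_const, Finset.card_univ, Fintype.card_prod, nsmul_eq_mul, Nat.cast_mul]
  obtain ⟨hs, ht⟩ := tsum_cols_le_of_sum_prod_le h0 hsum
  exact ⟨out, h0, hdom, summable_col_of_sum_prod_le h0 hsum, hs, ht⟩

end Weighted

/-! ## §3 The weighted tower in total-mass currency -/

section Tower

variable {K : ℕ → MKer (d + 1) (Fib d)} {C δ : ℕ → ℝ} {c cH : ℕ → ℝ}
  {E E' : ℕ → Site (d + 1) → Site (d + 1) → ℝ} {hL hR ZE ZE' : ℕ → ℝ}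
  {S : Fin (d + 1) → (Fin (d + 1) → ℤ) → MKer (d + 1) (Fib d)} {B : ℝ}

/-- NOT IN PRINT; OUR BOOKKEEPING (PART 6 §3's structural recursion with §2 of THIS file at the top level).  **THE FLUX TOWER IN TOTAL MASS, COARSE-WEIGHT LEGS**: kernels `K_j`
decaying (`C_j`, `δ_j > 0` — used only for the identities `regionSum_divV_e3OfK` ∕ `exists_bdd_transport`) and, for the GAIN, windowed per level at the dilation `N` by weights
`E_j, E′_j ∈ [0,1]` with dilated-point sups `h_{L,j}, h_{R,j} ≥ 0` and coarse sums `≤ Z_{E,j}, Z_{E′,j}`; `N ≥ 1`, scalars `c_j`, a bounded bottom letter `S`, (hH)_j with `c_{H,j}`: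
if the bottom letter's flux through `U_{N^k}(T)` admits a mass function `μ` of total `M₁`, the flux of `transport (j S ↦ c_j • e3OfK N K_j S) m k S` through `T` admits one of total
`≤ (∏_{i<k} |Fib d|²·(|c_{m+i}·c_{H,m+i}|·|Fib d|²·h_{L,m+i}·h_{R,m+i}·Z_{E′,m+i}·Z_{E,m+i}))·M₁` — NO `Z_{δ_j}`, NO `C_j²`. -/
theorem exists_mass_regionSum_divV_transport_weight (hK : ∀ j, Decays (K j) (C j) (δ j)) (hδ : ∀ j, 0 < δ j) (hN : 1 ≤ N)
    (hE0 : ∀ j x p, 0 ≤ E j x p) (hE1 : ∀ j x p, E j x p ≤ 1) (hE'0 : ∀ j q z, 0 ≤ E' j q z) (hE'1 : ∀ j q z, E' j q z ≤ 1)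
    (hhL : ∀ j, 0 ≤ hL j) (hhR : ∀ j, 0 ≤ hR j)
    (hKL : ∀ j (x' p : Site (d + 1)) (a f : Fib d), |K j ((N : ℤ) • x') p a f| ≤ hL j * E j x' p)
    (hKR : ∀ j (q z' : Site (d + 1)) (f b : Fib d), |K j q ((N : ℤ) • z') f b| ≤ hR j * E' j q z')
    (hZE : ∀ j (p : Site (d + 1)) (Fx : Finset (Site (d + 1))), ∑ x' ∈ Fx, E j x' p ≤ ZE j)
    (hZE' : ∀ j (q : Site (d + 1)) (Fz : Finset (Site (d + 1))), ∑ z' ∈ Fz, E' j q z' ≤ ZE' j)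
    (hS : ∀ κ u x z a b, |S κ u x z a b| ≤ B)
    (hH : ∀ (j : ℕ) (y : Fin (d + 1) → ℤ) (κ' : Fin (d + 1)) (u : Fin (d + 1) → ℤ),
      ∑ μ', (colH (K j) N μ' (y - unitVec μ') κ' u - colH (K j) N μ' y κ' u) = cH j * gaugeWt N y κ' u)
    (m : ℕ) : ∀ (k : ℕ) (T : Finset (Site (d + 1))) (μ : Site (d + 1) → Site (d + 1) → ℝ),
    (∀ y w, 0 ≤ μ y w) →
    (∀ y w f g, |(∑ u ∈ T.biUnion (fun Y => (box (d + 1) (N ^ k)).image (fun v => ((N ^ k : ℕ) : ℤ) • Y + toSite v)), divV S u) y w f g| ≤ μ y w) →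
    (∀ w, Summable fun y => μ y w) → (Summable fun w => ∑' y, μ y w) →
    ∃ μ' : Site (d + 1) → Site (d + 1) → ℝ,
      (∀ x z, 0 ≤ μ' x z) ∧ (∀ x z a b, |(∑ Y ∈ T, divV (transport (fun j S => c j • e3OfK N (K j) S) m k S) Y) x z a b| ≤ μ' x z) ∧
        (∀ z, Summable fun x => μ' x z) ∧ (Summable fun z => ∑' x, μ' x z) ∧
        ∑' z, ∑' x, μ' x z ≤ (∏ i ∈ Finset.range k, (((Fintype.card (Fib d) : ℝ) * (Fintype.card (Fib d) : ℝ)) *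
          (|c (m + i) * cH (m + i)| * (((Fintype.card (Fib d) : ℝ) * ((Fintype.card (Fib d) : ℝ) * (hL (m + i) * hR (m + i))))
            * ZE' (m + i) * ZE (m + i))))) * ∑' w, ∑' y, μ y w
  | 0, T, μ, hμ0, hVμ, hμy, hμw => by
    refine ⟨μ, hμ0, fun x z a b => ?_, hμy, hμw, by rw [Finset.prod_range_zero, one_mul]⟩
    rw [regionSum_divV_transport hK hδ hN hS hH m 0 T, transport_zero]
    exact hVμ x z a b
  | k + 1, T, μ, hμ0, hVμ, hμy, hμw => by
    classical
    obtain ⟨B', hB'⟩ := exists_bdd_transport hK hδ c N hS m k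
    have hNk : 1 ≤ N ^ k := Nat.one_le_pow _ _ (Nat.pos_of_ne_zero (Nat.one_le_iff_ne_zero.1 hN))
    have e2 : (T.biUnion (fun Y => (box (d + 1) N).image (fun v => (N : ℤ) • Y + toSite v))).biUnion
          (fun Y' => (box (d + 1) (N ^ k)).image (fun v => ((N ^ k : ℕ) : ℤ) • Y' + toSite v))
        = T.biUnion (fun Y => (box (d + 1) (N ^ (k + 1))).image (fun s => ((N ^ (k + 1) : ℕ) : ℤ) • Y + toSite s)) := by
      rw [Finset.biUnion_biUnion]
      refine Finset.biUnion_congr rfl fun Y _ => ?_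
      rw [pow_succ]
      exact biUnion_box_image_eq hNk N Y
    have hVμ' : ∀ y w f g, |(∑ u ∈ (T.biUnion (fun Y => (box (d + 1) N).image (fun v => (N : ℤ) • Y + toSite v))).biUnion
        (fun Y' => (box (d + 1) (N ^ k)).image (fun v => ((N ^ k : ℕ) : ℤ) • Y' + toSite v)), divV S u) y w f g| ≤ μ y w := by
      rw [e2]; exact hVμ
    obtain ⟨μ₁, h10, h1dom, h1y, h1w, h1tot⟩ := exists_mass_regionSum_divV_transport_weight hK hδ hN hE0 hE1 hE'0 hE'1 hhL hhR hKL hKR hZE hZE'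
      hS hH m k (T.biUnion (fun Y => (box (d + 1) N).image (fun v => (N : ℤ) • Y + toSite v))) μ hμ0 hVμ' hμy hμw
    have e1 : ∑ Y ∈ T, divV (c (m + k) • e3OfK N (K (m + k)) (transport (fun j S => c j • e3OfK N (K j) S) m k S)) Y
        = c (m + k) • ∑ Y ∈ T, divV (e3OfK N (K (m + k)) (transport (fun j S => c j • e3OfK N (K j) S) m k S)) Y := by
      rw [Finset.smul_sum]
      exact Finset.sum_congr rfl fun Y _ => divV_smul_family _ _ Y
    have etop : ∑ Y ∈ T, divV (transport (fun j S => c j • e3OfK N (K j) S) m (k + 1) S) Y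
        = (-(c (m + k) * cH (m + k))) • mmRead N (comp (comp (K (m + k))
            (∑ u ∈ T.biUnion (fun Y => (box (d + 1) N).image (fun v => (N : ℤ) • Y + toSite v)),
              divV (transport (fun j S => c j • e3OfK N (K j) S) m k S) u)) (K (m + k))) := by
      simp only [transport_succ]
      rw [e1, regionSum_divV_e3OfK (hK (m + k)) (hδ (m + k)) hN hB' (hH (m + k)) T, smul_neg, smul_smul, ← neg_smul]
    obtain ⟨μ', h0', hdom', hy', hw', htot'⟩ :=
      exists_mass_smul_mmRead_sandwich_weight (N := N) (hE0 (m + k)) (hE1 (m + k)) (hE'0 (m + k)) (hE'1 (m + k)) (hhL (m + k)) (hhR (m + k))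
        (hKL (m + k)) (hKR (m + k)) (hZE (m + k)) (hZE' (m + k)) h10 h1dom h1y h1w (-(c (m + k) * cH (m + k)))
    refine ⟨μ', h0', fun x z a b => ?_, hy', hw', ?_⟩
    · rw [etop]; exact hdom' x z a b
    · rw [abs_neg] at htot'
      refine htot'.trans ?_
      rw [Finset.prod_range_succ]
      have hZE0 : 0 ≤ ZE (m + k) := le_trans (by simp) (hZE (m + k) 0 ∅)
      have hZE'0 : 0 ≤ ZE' (m + k) := le_trans (by simp) (hZE' (m + k) 0 ∅)
      have hg : 0 ≤ ((Fintype.card (Fib d) : ℝ) * (Fintype.card (Fib d) : ℝ)) *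
          (|c (m + k) * cH (m + k)| * (((Fintype.card (Fib d) : ℝ) * ((Fintype.card (Fib d) : ℝ) * (hL (m + k) * hR (m + k))))
            * ZE' (m + k) * ZE (m + k))) := by
        have := hhL (m + k)
        have := hhR (m + k)
        positivity
      calc ((Fintype.card (Fib d) : ℝ) * (Fintype.card (Fib d) : ℝ)) * (|c (m + k) * cH (m + k)| * ((Fintype.card (Fib d) : ℝ)
              * ((Fintype.card (Fib d) : ℝ) * (hL (m + k) * hR (m + k))) * ZE' (m + k) * (ZE (m + k) * ∑' z, ∑' x, μ₁ x z)))
          = (((Fintype.card (Fib d) : ℝ) * (Fintype.card (Fib d) : ℝ)) * (|c (m + k) * cH (m + k)| * (((Fintype.card (Fib d) : ℝ)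
              * ((Fintype.card (Fib d) : ℝ) * (hL (m + k) * hR (m + k)))) * ZE' (m + k) * ZE (m + k))))
              * ∑' z, ∑' x, μ₁ x z := by ring
        _ ≤ (((Fintype.card (Fib d) : ℝ) * (Fintype.card (Fib d) : ℝ)) * (|c (m + k) * cH (m + k)| * (((Fintype.card (Fib d) : ℝ)
              * ((Fintype.card (Fib d) : ℝ) * (hL (m + k) * hR (m + k)))) * ZE' (m + k) * ZE (m + k))))
              * ((∏ i ∈ Finset.range k, (((Fintype.card (Fib d) : ℝ) * (Fintype.card (Fib d) : ℝ)) *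
                (|c (m + i) * cH (m + i)| * (((Fintype.card (Fib d) : ℝ) * ((Fintype.card (Fib d) : ℝ) * (hL (m + i) * hR (m + i))))
                  * ZE' (m + i) * ZE (m + i))))) * ∑' w, ∑' y, μ y w) :=
            mul_le_mul_of_nonneg_left h1tot hg
        _ = _ := by ring

end Tower

end Summit.QuantumFields.BalabanUV.Beta.GAN24.BlockFluxMassTowerWeight

end
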